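import Mathlib.NumberTheory.Harmonic.Bounds
import Literature.Barriers.CriticalPhenomena.WeaklySAWCriticalNuFirstOrder
import Literature.Probability.LatticeModels.SRWReturnFourier
import HarnessLib

/-!
# The critical value of the weakly self-avoiding walk to order `g^{4/3} log g⁻¹`, without the
# renormalisation group (Bauerschmidt–Brydges–Slade 2015, Theorem 1.2: quantitative elementary part)

Companion to `WeaklySAWCriticalNuFirstOrder.lean` (namespace
`Literature.Barriers.CriticalPhenomena.CTWSAW`). Theorem 1.2 of the source
(`CTWSAW.BBS2015_thm12`: `d = 4`, `ν_c(g) = -ag + O(g²)`, `a = 2C₀(0)`) is proved there only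
through the rigorous renormalisation group (its §8.5; in the tree it follows from the named fact
`CTWSAW.BBS2015_thm41_nu0c`). The first-order file proves `ν_c(g) = -ag + o(g)` by elementary
means but without a rate, because the rate of `E₀ I(T)/T → a` was not quantified. The tree now
holds the on-diagonal heat-kernel bound `pₘ(0) ≤ C₄/m²` for the simple random walk on `ℤ⁴`
(`SRW.prob_four_zero_le`, `Probability/LatticeModels/SRWReturnFourier.lean`) and the Green-function
tail `Σ_{m>n} pₘ(0) ≤ C₄/n` (`SRW.green4_sub_partial_le`); feeding them into the exact layer formula
of the first-order file gives, still without any renormalisation-group input: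

* `closedWords_eq_count`, `closedWords_div_pow_eq_prob`, `greenZero_eq_inv_mul_tsum`,
  `greenZero_four_eq` — the glue between the jump-chain bookkeeping of the weakly self-avoiding
  walk files (`closedWords d m = R_m`, `greenZero d = C₀(0)`) and the simple-random-walk layer
  (`SRW.count`, `SRW.prob`, `SRW.green4`): `R_m = SRW.count d m 0`, `R_m/(2d)^m = pₘ(0)`,
  `C₀(0) = (2d)⁻¹ Σₘ pₘ(0)` (`d ≥ 3`), **`greenZero 4 = SRW.green4 / 8`** (the identification
  announced in the docstring of `SRW.green4`);
* `partialGreen_le_toReal_meanSelfIntersection_add` — the real form of the layer comparison: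
  `2T(2d)⁻¹ Σ_{m≤M} pₘ(0) ≤ E₀ I(T) + 2(2d)⁻² Σ_{m≤M} (m+1) pₘ(0)` (`d ≥ 1`);
* `two_greenZero_mul_le_toReal_meanSelfIntersection_add`,
  `abs_toReal_meanSelfIntersection_sub_le` — **`E₀ I(T) = aT + O(log T)` on `ℤ⁴`**:
  `|E₀ I(T) - aT| ≤ (C₄ + 1)(1 + log T)` for `T ≥ 1` (the logarithm is the `d = 4` phenomenon
  `∫₀ᵀ u p_u(0) du ≍ log T`);
* `criticalNu_add_le_of_mul_sq_le` — the master inequality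
  `ν_c(g) + ag ≤ a g²T² + (C₄+1) g (1 + log T)/T` for `g > 0`, `T ≥ 1`, `gT² ≤ 1`
  (from `ν_c ≤ -g(1 - gT²) E₀ I(T)/T` of the first-order file; `0 ≤ ν_c(g) + ag` is Lemma A.1,
  `BBS2015_thm12_lower`);
* `abs_criticalNu_add_le_rpow`, `BBS2015_thm12_rate` — **`|ν_c(g) + ag| ≤ C g^{4/3}(1 + log g⁻¹)`
  for `0 < g ≤ 1`**, `C = a + C₄ + 1` (the choice `T = g^{-1/3}`).

This is Theorem 1.2 with the error `O(g²)` weakened to `O(g^{4/3} log g⁻¹)`; the exponent `4/3`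
is an artefact of the second-order bound `c_T ≤ 1 - gE₀I(T) + g²T²E₀I(T)` (no variance
information on `I(T)`), and the remaining gap to `O(g²)` is exactly the renormalisation-group
content of the source. No new definitions and no named facts are introduced.

## References
* R. Bauerschmidt, D. C. Brydges, G. Slade, *Logarithmic correction for the susceptibility of the
  4-dimensional weakly self-avoiding walk: a renormalisation group analysis*, CMP 337 (2015),
  arXiv:1403.7422: Theorem 1.2, §1.3, Lemma A.1. [BauerschmidtBrydgesSlade2015LogCorr]
* G. F. Lawler, V. Limic, *Random Walk: A Modern Introduction* (2010), §2.4 (heat-kernel bound)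
  and Ch. 4 (Green function) — background for the inputs taken from `SRWReturnFourier.lean`.
-/

noncomputable section

open MeasureTheory Filter Topology Set Literature.Probability.LatticeModels
open scoped ENNReal BigOperators Nat

namespace Literature.Barriers.CriticalPhenomena

namespace CTWSAW

variable {d : ℕ}

/-! ### Glue: closed words are the return counts of `SRW`, and `C₀(0)` through `SRW.prob` -/

/-- `R_m = closedWords d m` is the simple-random-walk return count `SRW.count d m 0`. [folklore] -/
theorem closedWords_eq_count (d m : ℕ) : closedWords d m = SRW.count d m 0 := by
  rw [closedWords_eq_card, SRW.card_finsetWalkLength_eq_count]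

/-- `R_m/(2d)^m = pₘ(0)`, the `m`-step return probability `SRW.prob d m 0`. [folklore] -/
theorem closedWords_div_pow_eq_prob (d m : ℕ) :
    (closedWords d m : ℝ) / (2 * d : ℝ) ^ m = SRW.prob d m 0 := by
  rw [SRW.prob, closedWords_eq_count]

/-- `R_m (2d)^{-(m+1)} = (2d)⁻¹ pₘ(0)`. [folklore] -/
theorem closedWords_mul_inv_pow_succ (d m : ℕ) :
    (closedWords d m : ℝ) * ((2 * d : ℝ)⁻¹) ^ (m + 1) = (2 * d : ℝ)⁻¹ * SRW.prob d m 0 := by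
  rw [← closedWords_div_pow_eq_prob, pow_succ, inv_pow, div_eq_mul_inv]
  ring

/-- The return probabilities `pₘ(0)` are summable for `d ≥ 3` (transience; the tree's
`summable_prob_zero` read through `SRW.card_finsetWalkLength_eq_count`). [folklore] -/
theorem summable_prob_origin (hd : 3 ≤ d) : Summable fun m : ℕ => SRW.prob d m 0 := by
  refine (summable_prob_zero hd).congr fun n => ?_
  rw [SRW.prob, SRW.card_finsetWalkLength_eq_count]

/-- **`C₀(0) = (2d)⁻¹ Σₘ pₘ(0)`** for `d ≥ 3`: the expected time spent at the origin by the
rate-`2d` continuous-time walk is the expected number of visits of its jump chain divided by the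
jump rate. [cite: BauerschmidtBrydgesSlade2015LogCorr, §1.2 (definition of C₀(0))] -/
theorem greenZero_eq_inv_mul_tsum (hd : 3 ≤ d) :
    greenZero d = (2 * d : ℝ)⁻¹ * ∑' m : ℕ, SRW.prob d m 0 := by
  have hd0 : 0 < d := by omega
  rw [greenZero_eq_toReal, greenLintegral_eq_greenSeries hd0,
    greenSeries_eq_ofReal_tsum hd0 (summable_prob_zero hd), ENNReal.toReal_ofReal]
  · congr 1
    refine tsum_congr fun n => ?_
    rw [SRW.prob, SRW.card_finsetWalkLength_eq_count]
  · exact mul_nonneg (inv_nonneg.2 (by positivity)) (tsum_nonneg fun n => by positivity)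

/-- **`greenZero 4 = SRW.green4 / 8`**: the constant `C₀(0)` of Theorem 1.2 (`a = 2C₀(0)`) is the
discrete Green function `G = Σₘ pₘ(0)` of `SRWReturnFourier.lean` divided by the jump rate `8`
(the identification announced in the docstring of `SRW.green4`). [folklore] -/
theorem greenZero_four_eq : greenZero 4 = SRW.green4 / 8 := by
  rw [greenZero_eq_inv_mul_tsum (by norm_num), SRW.green4, div_eq_inv_mul]
  norm_num

/-- `a = 2C₀(0) = G/4` at `d = 4`. [folklore] -/
theorem two_mul_greenZero_four_eq : 2 * greenZero 4 = SRW.green4 / 4 := by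
  rw [greenZero_four_eq]
  ring

/-! ### The layer comparison in real form -/

/-- Finite sums `Σ R_m · f(m)` with `f ≥ 0` pass through `ENNReal.ofReal`. [folklore] -/
theorem sum_closedWords_mul_ofReal (d : ℕ) (s : Finset ℕ) {f : ℕ → ℝ} (hf : ∀ m, 0 ≤ f m) :
    ∑ m ∈ s, (closedWords d m : ℝ≥0∞) * ENNReal.ofReal (f m) =
      ENNReal.ofReal (∑ m ∈ s, (closedWords d m : ℝ) * f m) := by
  rw [ENNReal.ofReal_sum_of_nonneg fun m _ => mul_nonneg (Nat.cast_nonneg _) (hf m)]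
  refine Finset.sum_congr rfl fun m _ => ?_
  rw [ENNReal.ofReal_mul (Nat.cast_nonneg _), ENNReal.ofReal_natCast]

/-- **The layer comparison of `E₀ I(T)` in real form** (`d ≥ 1`, `T > 0`, any cut-off `M`):
`2T (2d)⁻¹ Σ_{m ≤ M} pₘ(0) ≤ E₀ I(T) + 2 (2d)⁻² Σ_{m ≤ M} (m+1) pₘ(0)`
(`partialGreen_le_meanSelfIntersection_add` with `R_m/(2d)^m = pₘ(0)`). [folklore] -/
theorem partialGreen_le_toReal_meanSelfIntersection_add (hd : 0 < d) (M : ℕ) {T : ℝ} (hT : 0 < T) :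
    2 * T * (2 * d : ℝ)⁻¹ * ∑ m ∈ Finset.range (M + 1), SRW.prob d m 0 ≤
      (meanSelfIntersection d T).toReal +
        2 * ((2 * d : ℝ)⁻¹) ^ 2 * ∑ m ∈ Finset.range (M + 1), ((m : ℝ) + 1) * SRW.prob d m 0 := by
  have h := partialGreen_le_meanSelfIntersection_add hd M hT
  have hmfin : meanSelfIntersection d T ≠ ∞ :=
    (lt_of_le_of_lt (meanSelfIntersection_le_sq d hT) ENNReal.ofReal_lt_top).ne
  have hL : 2 * ENNReal.ofReal T * ∑ m ∈ Finset.range (M + 1),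
      (closedWords d m : ℝ≥0∞) * (2 * d : ℝ≥0∞)⁻¹ ^ (m + 1) =
      ENNReal.ofReal (2 * T * (2 * d : ℝ)⁻¹ * ∑ m ∈ Finset.range (M + 1), SRW.prob d m 0) := by
    simp_rw [inv_two_mul_pow_eq_ofReal hd]
    rw [sum_closedWords_mul_ofReal d _ fun m => by positivity, ← ENNReal.ofReal_ofNat 2,
      ← ENNReal.ofReal_mul zero_le_two, ← ENNReal.ofReal_mul (by positivity)]
    congr 1
    rw [Finset.mul_sum, Finset.mul_sum]
    refine Finset.sum_congr rfl fun m _ => ?_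
    rw [closedWords_mul_inv_pow_succ]
    ring
  have hR : ∑ m ∈ Finset.range (M + 1),
      (closedWords d m : ℝ≥0∞) * ENNReal.ofReal (2 * (m + 1) * ((2 * d : ℝ)⁻¹) ^ (m + 2)) =
      ENNReal.ofReal (2 * ((2 * d : ℝ)⁻¹) ^ 2 *
        ∑ m ∈ Finset.range (M + 1), ((m : ℝ) + 1) * SRW.prob d m 0) := by
    rw [sum_closedWords_mul_ofReal d _ fun m => by positivity]
    congr 1
    rw [Finset.mul_sum]
    refine Finset.sum_congr rfl fun m _ => ?_
    rw [← closedWords_div_pow_eq_prob, pow_add, inv_pow, div_eq_mul_inv]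
    ring
  have hRnn : 0 ≤ 2 * ((2 * d : ℝ)⁻¹) ^ 2 *
      ∑ m ∈ Finset.range (M + 1), ((m : ℝ) + 1) * SRW.prob d m 0 :=
    mul_nonneg (by positivity)
      (Finset.sum_nonneg fun m _ => mul_nonneg (by positivity) (SRW.prob_nonneg _ _))
  rw [hL, hR] at h
  have h' : ENNReal.ofReal (2 * T * (2 * d : ℝ)⁻¹ * ∑ m ∈ Finset.range (M + 1), SRW.prob d m 0) ≤
      ENNReal.ofReal ((meanSelfIntersection d T).toReal +
        2 * ((2 * d : ℝ)⁻¹) ^ 2 * ∑ m ∈ Finset.range (M + 1), ((m : ℝ) + 1) * SRW.prob d m 0) := by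
    rwa [ENNReal.ofReal_add ENNReal.toReal_nonneg hRnn, ENNReal.ofReal_toReal hmfin]
  exact (ENNReal.ofReal_le_ofReal_iff (add_nonneg ENNReal.toReal_nonneg hRnn)).1 h'

/-! ### Dimension four: `E₀ I(T) = aT + O(log T)` -/

/-- `Σ_{m ≤ M} (m+1) pₘ(0) ≤ 1 + 2C₄(1 + log M)` on `ℤ⁴` (heat-kernel bound `pₘ(0) ≤ C₄/m²` and the
harmonic sum). [folklore] -/
theorem sum_succ_mul_prob_four_le (M : ℕ) :
    ∑ m ∈ Finset.range (M + 1), ((m : ℝ) + 1) * SRW.prob 4 m 0 ≤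
      1 + 2 * SRW.retConst 4 * (1 + Real.log M) := by
  have hc : 0 ≤ SRW.retConst 4 := (SRW.retConst_pos (d := 4) (by norm_num)).le
  rw [Finset.sum_range_succ']
  have h0 : (((0 : ℕ) : ℝ) + 1) * SRW.prob 4 0 0 = 1 := by simp [SRW.prob_zero]
  rw [h0, add_comm]
  gcongr
  calc ∑ m ∈ Finset.range M, (((m + 1 : ℕ) : ℝ) + 1) * SRW.prob 4 (m + 1) 0
      ≤ ∑ m ∈ Finset.range M, 2 * SRW.retConst 4 * ((m : ℝ) + 1)⁻¹ := by
        refine Finset.sum_le_sum fun m _ => ?_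
        have hp := SRW.prob_four_zero_le (m := m + 1) (by omega)
        have hx : (1 : ℝ) ≤ (m : ℝ) + 1 := by
          have : (0 : ℝ) ≤ m := Nat.cast_nonneg m
          linarith
        have hx0 : (0 : ℝ) < (m : ℝ) + 1 := by positivity
        calc (((m + 1 : ℕ) : ℝ) + 1) * SRW.prob 4 (m + 1) 0
            ≤ (((m + 1 : ℕ) : ℝ) + 1) * (SRW.retConst 4 / ((m + 1 : ℕ) : ℝ) ^ 2) :=
              mul_le_mul_of_nonneg_left hp (by positivity)
          _ = SRW.retConst 4 * (((m : ℝ) + 1 + 1) / ((m : ℝ) + 1) ^ 2) := by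
              push_cast
              ring
          _ ≤ SRW.retConst 4 * (2 / ((m : ℝ) + 1)) := by
              refine mul_le_mul_of_nonneg_left ?_ hc
              rw [div_le_div_iff₀ (by positivity) hx0]
              nlinarith
          _ = 2 * SRW.retConst 4 * ((m : ℝ) + 1)⁻¹ := by ring
    _ = 2 * SRW.retConst 4 * (harmonic M : ℝ) := by
        rw [← Finset.mul_sum]
        congr 1
        simp only [harmonic, Rat.cast_sum, Rat.cast_inv, Rat.cast_add, Rat.cast_natCast,
          Rat.cast_one, Nat.cast_add, Nat.cast_one]
    _ ≤ 2 * SRW.retConst 4 * (1 + Real.log M) :=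
        mul_le_mul_of_nonneg_left (harmonic_le_one_add_log M) (by positivity)

/-- **`E₀ I(T) ≥ aT - (C₄+1)(1 + log T)` on `ℤ⁴`** (`T ≥ 1`, `a = 2C₀(0)`, `C₄ = SRW.retConst 4`):
the layer comparison at cut-off `M = ⌈T⌉`, the Green-function tail `G - G_M ≤ C₄/M` and
`Σ_{m≤M}(m+1)pₘ(0) = O(log M)`. Together with `E₀ I(T) ≤ aT` (Lemma A.1) this is
`E₀ I(T) = aT + O(log T)`, the mean self-intersection time of the four-dimensional walk.
[folklore] -/
theorem two_greenZero_mul_le_toReal_meanSelfIntersection_add {T : ℝ} (hT : 1 ≤ T) :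
    2 * greenZero 4 * T ≤
      (meanSelfIntersection 4 T).toReal + (SRW.retConst 4 + 1) * (1 + Real.log T) := by
  have hT0 : 0 < T := by linarith
  set c := SRW.retConst 4 with hc_def
  have hc : 0 ≤ c := (SRW.retConst_pos (d := 4) (by norm_num)).le
  set M := ⌈T⌉₊ with hM
  have hM1 : 1 ≤ M := Nat.ceil_pos.2 hT0
  have hMpos : (0 : ℝ) < M := by exact_mod_cast hM1
  have hTM : T ≤ M := Nat.le_ceil T
  have hM2 : (M : ℝ) ≤ 2 * T := by
    have := Nat.ceil_lt_add_one hT0.le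
    rw [← hM] at this
    linarith
  have hP := partialGreen_le_toReal_meanSelfIntersection_add (d := 4) (by norm_num) M hT0
  have hS := sum_succ_mul_prob_four_le M
  have htail : SRW.green4 - SRW.green4Partial M ≤ c / M := SRW.green4_sub_partial_le hM1
  have hGP : SRW.green4Partial M = ∑ m ∈ Finset.range (M + 1), SRW.prob 4 m 0 := rfl
  have hlog2 : Real.log 2 ≤ 1 := by
    have := Real.log_le_sub_one_of_pos (zero_lt_two' ℝ)
    linarith
  have hlogT : 0 ≤ Real.log T := Real.log_nonneg hT
  have hlogM : Real.log M ≤ 1 + Real.log T := by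
    calc Real.log M ≤ Real.log (2 * T) := Real.log_le_log hMpos hM2
      _ = Real.log 2 + Real.log T := Real.log_mul (by norm_num) hT0.ne'
      _ ≤ 1 + Real.log T := by linarith
  have htail' : T * (SRW.green4 - SRW.green4Partial M) ≤ c := by
    calc T * (SRW.green4 - SRW.green4Partial M) ≤ T * (c / M) :=
          mul_le_mul_of_nonneg_left htail hT0.le
      _ ≤ M * (c / M) := mul_le_mul_of_nonneg_right hTM (by positivity)
      _ = c := by field_simp
  have hclogM : c * Real.log M ≤ c * (1 + Real.log T) := mul_le_mul_of_nonneg_left hlogM hc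
  set E := (meanSelfIntersection 4 T).toReal with hE
  set P := ∑ m ∈ Finset.range (M + 1), SRW.prob 4 m 0 with hP_def
  set S := ∑ m ∈ Finset.range (M + 1), ((m : ℝ) + 1) * SRW.prob 4 m 0 with hS_def
  -- `hP : 2T·8⁻¹·P ≤ E + 2·8⁻²·S`, `hS : S ≤ 1 + 2c(1 + log M)`, `htail' : T(G - P) ≤ c`
  rw [hGP] at htail'
  have hP' : T * P / 4 ≤ E + S / 32 := by
    have e1 : 2 * T * (2 * (4 : ℕ) : ℝ)⁻¹ * P = T * P / 4 := by push_cast; ring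
    have e2 : 2 * ((2 * (4 : ℕ) : ℝ)⁻¹) ^ 2 * S = S / 32 := by push_cast; ring
    rw [e1, e2] at hP
    exact hP
  calc 2 * greenZero 4 * T = T * (SRW.green4 - P) / 4 + T * P / 4 := by
        rw [two_mul_greenZero_four_eq]; ring
    _ ≤ c / 4 + (E + S / 32) := by
        gcongr
    _ ≤ c / 4 + (E + (1 + 2 * c * (1 + Real.log M)) / 32) := by
        gcongr
    _ ≤ E + (c + 1) * (1 + Real.log T) := by
        nlinarith [hclogM, hc, hlogT]

/-- **`|E₀ I(T) - aT| ≤ (C₄+1)(1 + log T)` on `ℤ⁴`, `T ≥ 1`**: `E₀ I(T) = aT + O(log T)`.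
[folklore] -/
theorem abs_toReal_meanSelfIntersection_sub_le {T : ℝ} (hT : 1 ≤ T) :
    |(meanSelfIntersection 4 T).toReal - 2 * greenZero 4 * T| ≤
      (SRW.retConst 4 + 1) * (1 + Real.log T) := by
  have hT0 : 0 < T := by linarith
  have hG : greenSeries 4 ≠ ∞ := (greenSeries_lt_top (by norm_num)).ne
  have hup := toReal_meanSelfIntersection_le hG hT0
  have hlow := two_greenZero_mul_le_toReal_meanSelfIntersection_add hT
  have hK : 0 ≤ (SRW.retConst 4 + 1) * (1 + Real.log T) :=
    mul_nonneg (by have := SRW.retConst_pos (d := 4) (by norm_num); linarith)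
      (by have := Real.log_nonneg hT; linarith)
  rw [abs_le]
  constructor <;> linarith

/-! ### The master inequality and Theorem 1.2 to order `g^{4/3} log g⁻¹` -/

/-- **Master inequality for the critical value on `ℤ⁴`**: for `g > 0`, `T ≥ 1` with `gT² ≤ 1`,
`ν_c(g) + ag ≤ a g²T² + (C₄+1) g (1 + log T)/T` (`a = 2C₀(0)`), from
`ν_c ≤ -g(1-gT²) E₀I(T)/T` (`criticalNu_le_neg_mul_meanSelfIntersection`),
`E₀ I(T) ≥ aT - (C₄+1)(1+log T)` and `E₀ I(T) ≤ aT`. [folklore] -/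
theorem criticalNu_add_le_of_mul_sq_le {g T : ℝ} (hg : 0 < g) (hT : 1 ≤ T) (hgT : g * T ^ 2 ≤ 1) :
    criticalNu 4 g + 2 * greenZero 4 * g ≤
      2 * greenZero 4 * g ^ 2 * T ^ 2 + (SRW.retConst 4 + 1) * g * (1 + Real.log T) / T := by
  have hT0 : 0 < T := by linarith
  have hG : greenSeries 4 ≠ ∞ := (greenSeries_lt_top (by norm_num)).ne
  set E := (meanSelfIntersection 4 T).toReal with hE
  set a := 2 * greenZero 4 with ha
  set K := (SRW.retConst 4 + 1) * (1 + Real.log T) with hK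
  have hK0 : 0 ≤ K :=
    mul_nonneg (by have := SRW.retConst_pos (d := 4) (by norm_num); linarith)
      (by have := Real.log_nonneg hT; linarith)
  have ha0 : 0 ≤ a := by
    have := greenZero_pos (d := 4) (by norm_num)
    rw [ha]; linarith
  have hEup : E ≤ a * T := toReal_meanSelfIntersection_le hG hT0
  have hElow : a * T ≤ E + K := two_greenZero_mul_le_toReal_meanSelfIntersection_add hT
  have hν := criticalNu_le_neg_mul_meanSelfIntersection (d := 4) (by norm_num) hg hT0
  have hu : 0 ≤ 1 - g * T ^ 2 := by linarith
  -- `-(g(1-gT²)) E ≤ -(g(1-gT²))(aT - K) = -gaT + g²T²·aT + gK - g²T²K ≤ -gaT + g²T²·aT + gK`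
  have h1 : -(g * (1 - g * T ^ 2)) * E ≤ -(g * (1 - g * T ^ 2)) * (a * T - K) := by
    have := mul_le_mul_of_nonneg_left (show a * T - K ≤ E by linarith) (mul_nonneg hg.le hu)
    linarith
  have hpos : 0 ≤ g ^ 2 * T ^ 2 * K := by positivity
  have hkey : -(g * (1 - g * T ^ 2)) * E ≤ -(g * a * T) + g ^ 2 * T ^ 2 * (a * T) + g * K := by
    nlinarith [h1, hpos]
  calc criticalNu 4 g + a * g ≤ -(g * (1 - g * T ^ 2)) * E / T + a * g := by linarith
    _ ≤ (-(g * a * T) + g ^ 2 * T ^ 2 * (a * T) + g * K) / T + a * g := by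
        gcongr
    _ = a * g ^ 2 * T ^ 2 + (SRW.retConst 4 + 1) * g * (1 + Real.log T) / T := by
        rw [hK]
        field_simp
        ring

/-- **The critical value to order `g^{4/3} log g⁻¹` (Theorem 1.2 of Bauerschmidt–Brydges–Slade 2015
with `O(g²)` weakened to `O(g^{4/3} log g⁻¹)`, proved without the renormalisation group)**: for
`0 < g ≤ 1`, `|ν_c(g) + ag| ≤ (a + C₄ + 1) g^{4/3} (1 + log g⁻¹)` with `a = 2C₀(0)` and
`C₄ = SRW.retConst 4` (the master inequality at `T = g^{-1/3}`; the lower inequality `ν_c ≥ -ag`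
is Lemma A.1, `BBS2015_thm12_lower`). The sharp `O(g²)` is `BBS2015_thm12`, i.e. the
renormalisation-group theorem of the source. [folklore] -/
theorem abs_criticalNu_add_le_rpow {g : ℝ} (hg : 0 < g) (hg1 : g ≤ 1) :
    |criticalNu 4 g + 2 * greenZero 4 * g| ≤
      (2 * greenZero 4 + SRW.retConst 4 + 1) * g ^ (4 / 3 : ℝ) * (1 + Real.log g⁻¹) := by
  set T : ℝ := g ^ (-(1 / 3 : ℝ)) with hT
  have hT1 : 1 ≤ T := Real.one_le_rpow_of_pos_of_le_one_of_nonpos hg hg1 (by norm_num)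
  have hT0 : 0 < T := by linarith
  have hc : 0 ≤ SRW.retConst 4 := (SRW.retConst_pos (d := 4) (by norm_num)).le
  have ha0 : 0 ≤ 2 * greenZero 4 := by
    have := greenZero_pos (d := 4) (by norm_num); linarith
  -- exponent bookkeeping
  have hT2 : T ^ 2 = g ^ (-(2 / 3 : ℝ)) := by
    rw [hT, ← Real.rpow_natCast, ← Real.rpow_mul hg.le]
    norm_num
  have hgT2 : g * T ^ 2 = g ^ (1 / 3 : ℝ) := by
    rw [hT2, mul_comm, ← Real.rpow_add_one hg.ne']
    norm_num
  have hg2T2 : g ^ 2 * T ^ 2 = g ^ (4 / 3 : ℝ) := by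
    rw [hT2, ← Real.rpow_natCast g 2, ← Real.rpow_add hg]
    norm_num
  have hTinv : T⁻¹ = g ^ (1 / 3 : ℝ) := by
    rw [hT, Real.rpow_neg hg.le, inv_inv]
  have hgdivT : g / T = g ^ (4 / 3 : ℝ) := by
    rw [div_eq_mul_inv, hTinv, mul_comm, ← Real.rpow_add_one hg.ne']
    norm_num
  have hlogT : Real.log T = 3⁻¹ * Real.log g⁻¹ := by
    rw [hT, Real.log_rpow hg, Real.log_inv]
    ring
  have hlogg : 0 ≤ Real.log g⁻¹ := by
    rw [Real.log_inv]
    have := Real.log_nonpos hg.le hg1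
    linarith
  have hgT : g * T ^ 2 ≤ 1 := by
    rw [hgT2]
    exact Real.rpow_le_one hg.le hg1 (by norm_num)
  have h43 : 0 ≤ g ^ (4 / 3 : ℝ) := Real.rpow_nonneg hg.le _
  -- the two inequalities
  have hlow : 0 ≤ criticalNu 4 g + 2 * greenZero 4 * g := by
    have := BBS2015_thm12_lower g hg
    linarith
  have hup := criticalNu_add_le_of_mul_sq_le hg hT1 hgT
  rw [abs_of_nonneg hlow]
  have e1 : 2 * greenZero 4 * g ^ 2 * T ^ 2 = 2 * greenZero 4 * g ^ (4 / 3 : ℝ) := by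
    rw [mul_assoc, hg2T2]
  have e2 : (SRW.retConst 4 + 1) * g * (1 + Real.log T) / T =
      (SRW.retConst 4 + 1) * g ^ (4 / 3 : ℝ) * (1 + 3⁻¹ * Real.log g⁻¹) := by
    rw [hlogT, ← hgdivT]
    field_simp
  rw [e1, e2] at hup
  have h3 : 1 + 3⁻¹ * Real.log g⁻¹ ≤ 1 + Real.log g⁻¹ := by linarith
  have h4 : (SRW.retConst 4 + 1) * g ^ (4 / 3 : ℝ) * (1 + 3⁻¹ * Real.log g⁻¹) ≤
      (SRW.retConst 4 + 1) * g ^ (4 / 3 : ℝ) * (1 + Real.log g⁻¹) :=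
    mul_le_mul_of_nonneg_left h3 (by positivity)
  have h5 : 2 * greenZero 4 * g ^ (4 / 3 : ℝ) ≤
      2 * greenZero 4 * g ^ (4 / 3 : ℝ) * (1 + Real.log g⁻¹) := by
    have := mul_le_mul_of_nonneg_left (show (1 : ℝ) ≤ 1 + Real.log g⁻¹ by linarith)
      (mul_nonneg ha0 h43)
    linarith
  calc criticalNu 4 g + 2 * greenZero 4 * g
      ≤ 2 * greenZero 4 * g ^ (4 / 3 : ℝ) +
          (SRW.retConst 4 + 1) * g ^ (4 / 3 : ℝ) * (1 + 3⁻¹ * Real.log g⁻¹) := hup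
    _ ≤ 2 * greenZero 4 * g ^ (4 / 3 : ℝ) * (1 + Real.log g⁻¹) +
          (SRW.retConst 4 + 1) * g ^ (4 / 3 : ℝ) * (1 + Real.log g⁻¹) := add_le_add h5 h4
    _ = (2 * greenZero 4 + SRW.retConst 4 + 1) * g ^ (4 / 3 : ℝ) * (1 + Real.log g⁻¹) := by ring

/-- **Theorem 1.2 of Bauerschmidt–Brydges–Slade 2015 up to the power `g^{4/3} log g⁻¹`, without
the renormalisation group**: there is `C > 0` with `|ν_c(g) + ag| ≤ C g^{4/3}(1 + log g⁻¹)` for all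
`0 < g ≤ 1` (`d = 4`, `a = 2C₀(0)`). The statement `BBS2015_thm12` (`O(g²)`) is strictly
stronger and is the renormalisation-group content of the source.
[cite: BauerschmidtBrydgesSlade2015LogCorr, Theorem 1.2 (weakened error term; elementary proof)] -/
theorem BBS2015_thm12_rate :
    ∃ C : ℝ, 0 < C ∧ ∀ g : ℝ, 0 < g → g ≤ 1 →
      |criticalNu 4 g + 2 * greenZero 4 * g| ≤ C * g ^ (4 / 3 : ℝ) * (1 + Real.log g⁻¹) := by
  refine ⟨2 * greenZero 4 + SRW.retConst 4 + 1, ?_, fun g hg hg1 => abs_criticalNu_add_le_rpow hg hg1⟩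
  have := greenZero_pos (d := 4) (by norm_num)
  have := SRW.retConst_pos (d := 4) (by norm_num)
  linarith

end CTWSAW

end Literature.Barriers.CriticalPhenomena
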